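import Literature.Analysis.FluidPDE.TaoClassGlue
import Literature.Analysis.FluidPDE.ClassicalL2Stability

/-! # Tools for the time-stepping proof of `H¹` continuous dependence in Tao's class —
crux stmt-NavierStokesRegularity-0727 (`CertifiedBlowup.CertifiedBlowupAxisymBlowup`), line
`compact-amplification`, stub `stub_stability_of_step` (helper file)

Generic bookkeeping lemmas used by the time-stepping induction of
`CertifiedBlowupCertifiedBlowupAxisymBlowupStubStabilityOfStep.lean`: `[0, ∞]`/`ℝ` conversions
of `L²` bounds, the Frobenius norm of a sum, `L²` norms of differences of iterated derivatives,
the restart index `⌊t/σ⌋₊`, the smallness arithmetic, and the one analytic step: the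
interpolation `(∫|∇d|²)² ≤ K ∫‖d‖² ∫‖D²d‖²` (a hypothesis) turns `L²`-smallness of a difference
`d = f - g` with bounded `D²d` into `∫|∇d|² ≤ 1`, whence `∫|∇f|² ≤ 6 C₁ + 2` when
`∫‖D¹g‖² ≤ C₁`.
-/

set_option linter.dupNamespace false

noncomputable section

open MeasureTheory Set Function Filter Topology
open scoped ENNReal NNReal ContDiff

namespace Summit.NavierStokesRegularity.NavierStokesRegularity.Theorems.CertifiedBlowupAxisymBlowup.CompactAmplification

open Literature.Analysis.FluidPDE

/-! ### `[0, ∞]` arithmetic against `ENNReal.ofReal` bounds -/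

/-- `a ≤ ofReal x`, `b ≤ ofReal y`, `x + y ≤ z` give `a + b ≤ ofReal z` (`x, y ≥ 0`). -/
theorem stab_add_le_ofReal {a b : ℝ≥0∞} {x y z : ℝ} (ha : a ≤ ENNReal.ofReal x)
    (hb : b ≤ ENNReal.ofReal y) (hx : 0 ≤ x) (hy : 0 ≤ y) (h : x + y ≤ z) :
    a + b ≤ ENNReal.ofReal z :=
  calc a + b ≤ ENNReal.ofReal x + ENNReal.ofReal y := add_le_add ha hb
    _ = ENNReal.ofReal (x + y) := (ENNReal.ofReal_add hx hy).symm
    _ ≤ ENNReal.ofReal z := ENNReal.ofReal_le_ofReal h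

/-- `a ≤ ofReal x`, `b ≤ ofReal y`, `2x + 2y ≤ z` give `2a + 2b ≤ ofReal z` (`x, y ≥ 0`). -/
theorem stab_two_mul_add_le_ofReal {a b : ℝ≥0∞} {x y z : ℝ} (ha : a ≤ ENNReal.ofReal x)
    (hb : b ≤ ENNReal.ofReal y) (hx : 0 ≤ x) (hy : 0 ≤ y) (h : 2 * x + 2 * y ≤ z) :
    2 * a + 2 * b ≤ ENNReal.ofReal z :=
  calc 2 * a + 2 * b ≤ 2 * ENNReal.ofReal x + 2 * ENNReal.ofReal y := by gcongr
    _ = ENNReal.ofReal (2 * x + 2 * y) := by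
        rw [ENNReal.ofReal_add (by positivity) (by positivity), ENNReal.ofReal_mul zero_le_two,
          ENNReal.ofReal_mul zero_le_two, ENNReal.ofReal_ofNat]
    _ ≤ ENNReal.ofReal z := ENNReal.ofReal_le_ofReal h

/-- `a ≤ ofReal x`, `3x ≤ z` give `3a ≤ ofReal z`. -/
theorem stab_three_mul_le_ofReal {a : ℝ≥0∞} {x z : ℝ} (ha : a ≤ ENNReal.ofReal x)
    (h : 3 * x ≤ z) : 3 * a ≤ ENNReal.ofReal z :=
  calc 3 * a ≤ 3 * ENNReal.ofReal x := by gcongr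
    _ = ENNReal.ofReal (3 * x) := by
        rw [ENNReal.ofReal_mul zero_le_three, ENNReal.ofReal_ofNat]
    _ ≤ ENNReal.ofReal z := ENNReal.ofReal_le_ofReal h

/-- A bound by an `ℝ≥0` constant is a bound by `ofReal` of its real coercion. -/
theorem stab_le_ofReal_coe {a : ℝ≥0∞} {C : ℝ≥0} (h : a ≤ C) : a ≤ ENNReal.ofReal (C : ℝ) := by
  rwa [ENNReal.ofReal_coe_nnreal]

/-! ### `L²` conversions -/

/-- `∫⁻ ‖w‖ₑ² ≤ ofReal r` from `∫ ‖w‖² ≤ r` for `w ∈ L²`. -/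
theorem stab_lintegral_le_of_integral_le {w : EuclideanSpace ℝ (Fin 3) → EuclideanSpace ℝ (Fin 3)}
    (hw : MemLp w 2 volume) {r : ℝ} (h : ∫ x, ‖w x‖ ^ 2 ≤ r) :
    ∫⁻ x, ‖w x‖ₑ ^ 2 ≤ ENNReal.ofReal r := by
  rw [← ofReal_integral_sq_norm (hw.integrable_norm_pow two_ne_zero)]
  exact ENNReal.ofReal_le_ofReal h

/-- `∫ ‖w‖² ≤ r` from `∫⁻ ‖w‖ₑ² ≤ ofReal r` for `w ∈ L²`, `r ≥ 0`. -/
theorem stab_integral_le_of_lintegral_le {w : EuclideanSpace ℝ (Fin 3) → EuclideanSpace ℝ (Fin 3)}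
    (hw : MemLp w 2 volume) {r : ℝ} (hr : 0 ≤ r) (h : ∫⁻ x, ‖w x‖ₑ ^ 2 ≤ ENNReal.ofReal r) :
    ∫ x, ‖w x‖ ^ 2 ≤ r := by
  rw [← ofReal_integral_sq_norm (hw.integrable_norm_pow two_ne_zero)] at h
  exact (ENNReal.ofReal_le_ofReal_iff hr).1 h

/-- `∫⁻ ‖f‖ₑ² ≤ 2 ∫⁻ ‖g‖ₑ² + 2 ∫⁻ ‖f - g‖ₑ²` (measurable `g`). -/
theorem stab_lintegral_enorm_sq_le_add_sub {α : Type*} [MeasurableSpace α] {μ : Measure α}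
    {G : Type*} [NormedAddCommGroup G] {f g : α → G} (hg : AEStronglyMeasurable g μ) :
    ∫⁻ x, ‖f x‖ₑ ^ 2 ∂μ ≤ 2 * (∫⁻ x, ‖g x‖ₑ ^ 2 ∂μ) + 2 * ∫⁻ x, ‖f x - g x‖ₑ ^ 2 ∂μ := by
  have h := lintegral_enorm_sq_sub_le (g := fun x => g x - f x) hg (μ := μ)
  calc ∫⁻ x, ‖f x‖ₑ ^ 2 ∂μ = ∫⁻ x, ‖g x - (g x - f x)‖ₑ ^ 2 ∂μ :=
        lintegral_congr fun x => by rw [sub_sub_cancel]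
    _ ≤ 2 * (∫⁻ x, ‖g x‖ₑ ^ 2 ∂μ) + 2 * ∫⁻ x, ‖g x - f x‖ₑ ^ 2 ∂μ := h
    _ = 2 * (∫⁻ x, ‖g x‖ₑ ^ 2 ∂μ) + 2 * ∫⁻ x, ‖f x - g x‖ₑ ^ 2 ∂μ := by
        congr 2
        exact lintegral_congr fun x => by rw [enorm_sub_rev]

/-- `∫⁻ ‖Df‖ₑ² = ∫⁻ ‖D¹f‖ₑ²`. -/
theorem stab_lintegral_fderiv_eq_one (f : EuclideanSpace ℝ (Fin 3) → EuclideanSpace ℝ (Fin 3)) :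
    ∫⁻ x, ‖fderiv ℝ f x‖ₑ ^ 2 = ∫⁻ x, ‖iteratedFDeriv ℝ 1 f x‖ₑ ^ 2 :=
  lintegral_congr fun x => by rw [← ofReal_norm, ← ofReal_norm, norm_iteratedFDeriv_one]

/-- `∫⁻ ‖f‖ₑ² = ∫⁻ ‖D⁰f‖ₑ²`. -/
theorem stab_lintegral_eq_zero (f : EuclideanSpace ℝ (Fin 3) → EuclideanSpace ℝ (Fin 3)) :
    ∫⁻ x, ‖f x‖ₑ ^ 2 = ∫⁻ x, ‖iteratedFDeriv ℝ 0 f x‖ₑ ^ 2 :=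
  lintegral_congr fun x => by rw [← ofReal_norm, ← ofReal_norm, norm_iteratedFDeriv_zero]

/-- `∫⁻ |∇f|² ≤ 3 ∫⁻ ‖Df‖ₑ²`. -/
theorem stab_lintegral_frob_le_three_mul (f : EuclideanSpace ℝ (Fin 3) → EuclideanSpace ℝ (Fin 3)) :
    ∫⁻ x, ENNReal.ofReal (frobeniusNormSq (fderiv ℝ f x)) ≤ 3 * ∫⁻ x, ‖fderiv ℝ f x‖ₑ ^ 2 :=
  calc ∫⁻ x, ENNReal.ofReal (frobeniusNormSq (fderiv ℝ f x)) ≤ ∫⁻ x, 3 * ‖fderiv ℝ f x‖ₑ ^ 2 :=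
        lintegral_mono fun x => ofReal_frobeniusNormSq_le_three_mul_enorm_sq _
    _ = 3 * ∫⁻ x, ‖fderiv ℝ f x‖ₑ ^ 2 := lintegral_const_mul' _ _ (by norm_num)

/-- `∫⁻ |∇g|² ≤ ofReal (3 C₁)` when `∫⁻ ‖D¹g‖ₑ² ≤ ofReal C₁`. -/
theorem stab_lintegral_frob_le_of_one {g : EuclideanSpace ℝ (Fin 3) → EuclideanSpace ℝ (Fin 3)}
    {C₁ : ℝ} (h1 : ∫⁻ x, ‖iteratedFDeriv ℝ 1 g x‖ₑ ^ 2 ≤ ENNReal.ofReal C₁) :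
    ∫⁻ x, ENNReal.ofReal (frobeniusNormSq (fderiv ℝ g x)) ≤ ENNReal.ofReal (3 * C₁) := by
  refine (stab_lintegral_frob_le_three_mul g).trans (stab_three_mul_le_ofReal ?_ le_rfl)
  rwa [stab_lintegral_fderiv_eq_one]

/-- `∫ |∇g|² ≤ 3 C₁` (Bochner) when `∫⁻ ‖D¹g‖ₑ² ≤ ofReal C₁`, for a `C²` field `g`. -/
theorem stab_integral_frob_le {g : EuclideanSpace ℝ (Fin 3) → EuclideanSpace ℝ (Fin 3)} {C₁ : ℝ}
    (hg : ContDiff ℝ 2 g) (hC₁ : 0 ≤ C₁)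
    (h1 : ∫⁻ x, ‖iteratedFDeriv ℝ 1 g x‖ₑ ^ 2 ≤ ENNReal.ofReal C₁) :
    ∫ x, frobeniusNormSq (fderiv ℝ g x) ≤ 3 * C₁ := by
  rw [integral_eq_lintegral_of_nonneg_ae (Eventually.of_forall fun x => frobeniusNormSq_nonneg _)
    (continuous_frobeniusNormSq_fderiv hg (by simp)).aestronglyMeasurable]
  exact ENNReal.toReal_le_of_le_ofReal (by positivity) (stab_lintegral_frob_le_of_one h1)

/-! ### Differences -/

/-- `|L + M|² ≤ 2|L|² + 2|M|²` for the Frobenius norm. -/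
theorem stab_frobeniusNormSq_add_le
    (L M : EuclideanSpace ℝ (Fin 3) →L[ℝ] EuclideanSpace ℝ (Fin 3)) :
    frobeniusNormSq (L + M) ≤ 2 * frobeniusNormSq L + 2 * frobeniusNormSq M := by
  unfold frobeniusNormSq
  rw [Finset.mul_sum, Finset.mul_sum, ← Finset.sum_add_distrib]
  refine Finset.sum_le_sum fun i _ => ?_
  set a := L (stdOrthonormalBasis ℝ (EuclideanSpace ℝ (Fin 3)) i)
  set b := M (stdOrthonormalBasis ℝ (EuclideanSpace ℝ (Fin 3)) i)
  show ‖a + b‖ ^ 2 ≤ 2 * ‖a‖ ^ 2 + 2 * ‖b‖ ^ 2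
  nlinarith [norm_add_le a b, norm_nonneg (a + b), sq_nonneg (‖a‖ - ‖b‖), norm_nonneg a,
    norm_nonneg b]

/-- `ofReal |L + M|² ≤ 2 ofReal |L|² + 2 ofReal |M|²`. -/
theorem stab_ofReal_frobeniusNormSq_add_le
    (L M : EuclideanSpace ℝ (Fin 3) →L[ℝ] EuclideanSpace ℝ (Fin 3)) :
    ENNReal.ofReal (frobeniusNormSq (L + M)) ≤
      2 * ENNReal.ofReal (frobeniusNormSq L) + 2 * ENNReal.ofReal (frobeniusNormSq M) := by
  have h := ENNReal.ofReal_le_ofReal (stab_frobeniusNormSq_add_le L M)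
  rw [ENNReal.ofReal_add (mul_nonneg zero_le_two (frobeniusNormSq_nonneg _))
    (mul_nonneg zero_le_two (frobeniusNormSq_nonneg _)), ENNReal.ofReal_mul zero_le_two,
    ENNReal.ofReal_mul zero_le_two, ENNReal.ofReal_ofNat] at h
  exact h

/-- `∫⁻ |∇f|² ≤ 2 ∫⁻ |∇g|² + 2 ∫⁻ |∇(f - g)|²` for `C¹` fields (`Df = Dg + D(f - g)`). -/
theorem stab_lintegral_frob_le_of_sub {f g : EuclideanSpace ℝ (Fin 3) → EuclideanSpace ℝ (Fin 3)}
    (hf : ContDiff ℝ 1 f) (hg : ContDiff ℝ 1 g) :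
    ∫⁻ x, ENNReal.ofReal (frobeniusNormSq (fderiv ℝ f x)) ≤
      2 * (∫⁻ x, ENNReal.ofReal (frobeniusNormSq (fderiv ℝ g x))) +
        2 * ∫⁻ x, ENNReal.ofReal (frobeniusNormSq (fderiv ℝ (fun y => f y - g y) x)) := by
  have hmeas : Measurable fun x => ENNReal.ofReal (frobeniusNormSq (fderiv ℝ g x)) :=
    (continuous_frobeniusNormSq_fderiv hg one_ne_zero).measurable.ennreal_ofReal
  have hD : ∀ x, fderiv ℝ f x = fderiv ℝ g x + fderiv ℝ (fun y => f y - g y) x := fun x => by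
    rw [fderiv_fun_sub ((hf.differentiable one_ne_zero) x) ((hg.differentiable one_ne_zero) x),
      add_sub_cancel]
  calc ∫⁻ x, ENNReal.ofReal (frobeniusNormSq (fderiv ℝ f x))
      ≤ ∫⁻ x, (2 * ENNReal.ofReal (frobeniusNormSq (fderiv ℝ g x)) +
          2 * ENNReal.ofReal (frobeniusNormSq (fderiv ℝ (fun y => f y - g y) x))) :=
        lintegral_mono fun x => by
          rw [hD x]
          exact stab_ofReal_frobeniusNormSq_add_le _ _
    _ = 2 * (∫⁻ x, ENNReal.ofReal (frobeniusNormSq (fderiv ℝ g x))) +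
          2 * ∫⁻ x, ENNReal.ofReal (frobeniusNormSq (fderiv ℝ (fun y => f y - g y) x)) := by
        rw [lintegral_add_left' (hmeas.const_mul 2).aemeasurable,
          lintegral_const_mul' _ _ (by norm_num), lintegral_const_mul' _ _ (by norm_num)]

/-- `∫⁻ ‖Dⁿ(f - g)‖ₑ² ≤ 2 ∫⁻ ‖Dⁿf‖ₑ² + 2 ∫⁻ ‖Dⁿg‖ₑ²` for `Cⁿ` fields. -/
theorem stab_lintegral_iteratedFDeriv_sub_le
    {f g : EuclideanSpace ℝ (Fin 3) → EuclideanSpace ℝ (Fin 3)} {n : ℕ} (hf : ContDiff ℝ n f)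
    (hg : ContDiff ℝ n g) :
    ∫⁻ x, ‖iteratedFDeriv ℝ n (fun y => f y - g y) x‖ₑ ^ 2 ≤
      2 * (∫⁻ x, ‖iteratedFDeriv ℝ n f x‖ₑ ^ 2) + 2 * ∫⁻ x, ‖iteratedFDeriv ℝ n g x‖ₑ ^ 2 := by
  have h : ∀ x, iteratedFDeriv ℝ n (fun y => f y - g y) x =
      iteratedFDeriv ℝ n f x - iteratedFDeriv ℝ n g x := fun x =>
    fun_iteratedFDeriv_sub_apply hf.contDiffAt hg.contDiffAt
  calc ∫⁻ x, ‖iteratedFDeriv ℝ n (fun y => f y - g y) x‖ₑ ^ 2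
      = ∫⁻ x, ‖iteratedFDeriv ℝ n f x - iteratedFDeriv ℝ n g x‖ₑ ^ 2 :=
        lintegral_congr fun x => by rw [h x]
    _ ≤ _ := lintegral_enorm_sq_sub_le (hf.continuous_iteratedFDeriv le_rfl).aestronglyMeasurable

/-! ### Arithmetic -/

/-- The restart index: for `σ > 0`, `t ≥ 0` there is `i` with `iσ ≤ t < iσ + σ`. -/
theorem stab_floor {σ t : ℝ} (hσ : 0 < σ) (ht : 0 ≤ t) :
    ∃ i : ℕ, (i : ℝ) * σ ≤ t ∧ t < (i : ℝ) * σ + σ := by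
  refine ⟨⌊t / σ⌋₊, ?_, ?_⟩
  · have h := Nat.floor_le (div_nonneg ht hσ.le)
    rwa [le_div_iff₀ hσ] at h
  · have h := Nat.lt_floor_add_one (t / σ)
    rw [div_lt_iff₀ hσ] at h
    linarith

/-- The smallness arithmetic: `δ ≤ 1 / ((K + 1) M (2H + 2C + 1))` gives
`K (δ M) (2H + 2C) ≤ 1`. -/
theorem stab_small {K M H C P δ : ℝ} (hK : 0 ≤ K) (hM : 0 < M) (hH : 0 ≤ H) (hC : 0 ≤ C)
    (hP : P = (K + 1) * M * (2 * H + 2 * C + 1)) (hδ0 : 0 ≤ δ) (hδ : δ ≤ 1 / P) :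
    K * (δ * M) * (2 * H + 2 * C) ≤ 1 := by
  have hP0 : 0 < P := by rw [hP]; positivity
  have h1 : δ * P ≤ 1 := by rwa [le_div_iff₀ hP0] at hδ
  calc K * (δ * M) * (2 * H + 2 * C) ≤ (K + 1) * (δ * M) * (2 * H + 2 * C + 1) := by
        apply mul_le_mul _ (by linarith) (by positivity) (by positivity)
        exact mul_le_mul_of_nonneg_right (by linarith) (by positivity)
    _ = δ * P := by rw [hP]; ring
    _ ≤ 1 := h1

/-! ### The analytic step -/

/-- **The `H¹` recovery at a restart time.** If the interpolation
`(∫|∇d|²)² ≤ K ∫‖d‖² ∫‖D²d‖²` holds for `C²` fields with `d, Dd, D²d ∈ L²`, and `f, g` are `C²`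
with `D¹f ∈ L²`, `∫‖D¹g‖² ≤ C₁`, `∫‖f - g‖² ≤ L`, `∫‖D²(f - g)‖² ≤ D₂` and `K L D₂ ≤ 1`, then
`∫|∇(f - g)|² ≤ 1` and so `∫|∇f|² ≤ 6 C₁ + 2`. -/
theorem stab_frob_step :
    ∀ {K C₁ L D₂ : ℝ} {f g : EuclideanSpace ℝ (Fin 3) → EuclideanSpace ℝ (Fin 3)}, 0 ≤ K →
      (∀ d : EuclideanSpace ℝ (Fin 3) → EuclideanSpace ℝ (Fin 3), ContDiff ℝ 2 d →
        (∫⁻ x, ‖d x‖ₑ ^ 2) < ⊤ → (∫⁻ x, ‖iteratedFDeriv ℝ 1 d x‖ₑ ^ 2) < ⊤ →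
        (∫⁻ x, ‖iteratedFDeriv ℝ 2 d x‖ₑ ^ 2) < ⊤ →
        (∫⁻ x, ENNReal.ofReal (frobeniusNormSq (fderiv ℝ d x))) ^ 2 ≤
          ENNReal.ofReal K * (∫⁻ x, ‖d x‖ₑ ^ 2) * (∫⁻ x, ‖iteratedFDeriv ℝ 2 d x‖ₑ ^ 2)) →
      ContDiff ℝ 2 f → ContDiff ℝ 2 g → (∫⁻ x, ‖iteratedFDeriv ℝ 1 f x‖ₑ ^ 2) < ⊤ →
      (∫⁻ x, ‖iteratedFDeriv ℝ 1 g x‖ₑ ^ 2) ≤ ENNReal.ofReal C₁ → 0 ≤ C₁ →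
      (∫⁻ x, ‖f x - g x‖ₑ ^ 2) ≤ ENNReal.ofReal L → 0 ≤ L →
      (∫⁻ x, ‖iteratedFDeriv ℝ 2 (fun y => f y - g y) x‖ₑ ^ 2) ≤ ENNReal.ofReal D₂ →
      K * L * D₂ ≤ 1 →
      (∫⁻ x, ENNReal.ofReal (frobeniusNormSq (fderiv ℝ f x))) ≤ ENNReal.ofReal (6 * C₁ + 2) := by
  intro K C₁ L D₂ f g hK hint hf hg hf1 hg1 hC₁ hL hL0 hD hsmall
  have hd : ContDiff ℝ 2 (fun y => f y - g y) := hf.sub hg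
  have h0 : (∫⁻ x, ‖f x - g x‖ₑ ^ 2) < ⊤ := hL.trans_lt ENNReal.ofReal_lt_top
  have h1 : (∫⁻ x, ‖iteratedFDeriv ℝ 1 (fun y => f y - g y) x‖ₑ ^ 2) < ⊤ := by
    refine (stab_lintegral_iteratedFDeriv_sub_le (hf.of_le (by norm_num))
      (hg.of_le (by norm_num))).trans_lt (ENNReal.add_lt_top.2 ⟨?_, ?_⟩)
    · exact ENNReal.mul_lt_top ENNReal.ofNat_lt_top hf1
    · exact ENNReal.mul_lt_top ENNReal.ofNat_lt_top (hg1.trans_lt ENNReal.ofReal_lt_top)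
  have h2 : (∫⁻ x, ‖iteratedFDeriv ℝ 2 (fun y => f y - g y) x‖ₑ ^ 2) < ⊤ :=
    hD.trans_lt ENNReal.ofReal_lt_top
  have hX2 : (∫⁻ x, ENNReal.ofReal (frobeniusNormSq (fderiv ℝ (fun y => f y - g y) x))) ^ 2 ≤
      1 := by
    calc (∫⁻ x, ENNReal.ofReal (frobeniusNormSq (fderiv ℝ (fun y => f y - g y) x))) ^ 2
        ≤ ENNReal.ofReal K * (∫⁻ x, ‖f x - g x‖ₑ ^ 2) *
            (∫⁻ x, ‖iteratedFDeriv ℝ 2 (fun y => f y - g y) x‖ₑ ^ 2) := hint _ hd h0 h1 h2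
      _ ≤ ENNReal.ofReal K * ENNReal.ofReal L * ENNReal.ofReal D₂ := by gcongr
      _ = ENNReal.ofReal (K * L * D₂) := by
          rw [ENNReal.ofReal_mul (mul_nonneg hK hL0), ENNReal.ofReal_mul hK]
      _ ≤ ENNReal.ofReal 1 := ENNReal.ofReal_le_ofReal hsmall
      _ = 1 := ENNReal.ofReal_one
  have hX : (∫⁻ x, ENNReal.ofReal (frobeniusNormSq (fderiv ℝ (fun y => f y - g y) x))) ≤
      ENNReal.ofReal 1 := by
    rw [ENNReal.ofReal_one]
    exact (pow_le_one_iff two_ne_zero).1 hX2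
  calc (∫⁻ x, ENNReal.ofReal (frobeniusNormSq (fderiv ℝ f x)))
      ≤ 2 * (∫⁻ x, ENNReal.ofReal (frobeniusNormSq (fderiv ℝ g x))) +
          2 * ∫⁻ x, ENNReal.ofReal (frobeniusNormSq (fderiv ℝ (fun y => f y - g y) x)) :=
        stab_lintegral_frob_le_of_sub (hf.of_le (by norm_num)) (hg.of_le (by norm_num))
    _ ≤ ENNReal.ofReal (6 * C₁ + 2) :=
        stab_two_mul_add_le_ofReal (stab_lintegral_frob_le_of_one hg1) hX (by positivity)
          zero_le_one (by linarith)

end Summit.NavierStokesRegularity.NavierStokesRegularity.Theorems.CertifiedBlowupAxisymBlowup.CompactAmplification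

end
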